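import Mathlib
import HarnessLib
import Summits.HubbardSuperconductivity.HubbardSuperconductivity.Theorems.KLProgrammeKLRegimeSplitChildren

/-!
# Route `KLProgramme` — the four children of crux K3 `KLRegimeTwoPointLimit` (stmt-HubbardSuperconductivity-19937),
# WINDOW-PARAMETRISED and HARTREE-CORRECT (v3 = plan g9 Δ5, 2026-08-26T08:40:31Z), with the glue PROVED.  Seat p2.

COVARIANCE VS PHYSICAL CHEMICAL POTENTIAL.  D1's carrier `klEffectiveAction L M β U μ K e₀ n = hubbardEffectiveActionCT L M β U
μ 0 K Λ` takes the COVARIANCE potential `μ` of the Grassmann representation; with the tree's normal-ordered quartic interaction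
`hubbardInteraction L M β U` that representation computes the Hubbard torus at the PHYSICAL potential `μ + U/2` (Hartree shift:
`Literature/…/HubbardThermalTwoPointMatsubaraLimit.lean`, `tendsto_grassmannTwoPoint_eq_hubbardThermalTwoPoint_sub`, BGM 2006
(2.8)).  Hence the assembly child must conclude the two-point limit of `hubbardThermalTwoPoint β U (μ + U/2) L …` from hypotheses
at covariance potential `μ`, and the glue must run the children at `μ_c = μ - U/2` — which leaves K3's analysis window
`[-1, -0.15]` at its lower end by `U/2`.  The landed closed children `…KLRegimeSplit.Child.*` (v2,
`KLProgrammeKLRegimeSplitChildren.lean`) have the v1/v2 window `[-1, -0.15]` and `Child.TwoPointAssembly` concludes at the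
covariance `μ` — superseded (append-only tree) by the present WINDOW-PARAMETRISED statements:

* `EngineOn W`, `BetaSplitOn W`, `CountertermOn W` — the v2 bodies of `Child.Engine/BetaSplit/Counterterm` with the analysis
  window replaced by a parameter `W : Set ℝ` (covariance potentials);
* `TwoPointAssemblyOn W` — child 4 with hypotheses at covariance `μ ∈ W` and conclusion at the PHYSICAL `μ + U/2`;
* `klWindowC = [-1.05, -0.15]` — the covariance window serving K3 (`μ(δ) - U/2 ∈ klWindowC` for `μ(δ) ∈ [-1, -0.15]`, `U ≤ 1/10`);
  THE FILED CHILDREN are `EngineOn klWindowC`, `BetaSplitOn klWindowC`, `CountertermOn klWindowC`, `TwoPointAssemblyOn klWindowC`;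
* glue `inductionOn` (any `W` receiving `μ - U/2`) and `k3_induction : EngineOn klWindowC → BetaSplitOn klWindowC →
  CountertermOn klWindowC → TwoPointAssemblyOn klWindowC → KLRegimeTwoPointLimitMu (-1) (-0.15)` PROVED (`U₀ ≤ 1/10` added to the
  staged minimum; `Child.allScales` is the pure-logic strong induction), `k3_twoPointLimit_of_children` (K3's body given S0).

Constants threaded `G → P → Q → (R, c) → U₀` (Part 1); history `Child.Hist`; two-leg step `TwoLegStep` (Part 2 v2).  Nothing
here asserts anything about the Hubbard model.  References: HOME/DECOMP.md v8 §8 (j); HOME/planner-g9/SPLIT-ARCH.md; BGM 2006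
§2.1 (2.8), §2.4.
-/

noncomputable section

namespace Summit.HubbardSuperconductivity.HubbardSuperconductivity.Theorems.KLRegimeSplit

set_option linter.dupNamespace false -- summit = problem name (single-conjunct summit), D-0017

open Real Finset Filter Literature.MathematicalPhysics.QuantumLattice Literature.Probability.LatticeModels
open Literature.MathematicalPhysics.QuantumLattice.FermiRG
open Summit.HubbardSuperconductivity.HubbardSuperconductivity.Theorems.KLProgrammeLegKernels
open Summit.HubbardSuperconductivity.HubbardSuperconductivity.Theorems.DispersionFlow

/-! ## §1 The covariance window -/

/-- **The covariance window serving K3**: `[-1.05, -0.15]` — it receives `μ - U/2` for every physical `μ` in K3's analysis window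
`[-1, -0.15]` and every `0 < U ≤ 1/10` (`sub_half_mem_klWindowC`). -/
def klWindowC : Set ℝ := Set.Icc (-1.05 : ℝ) (-0.15)

/-- `μ - U/2 ∈ klWindowC` for `μ ∈ [-1, -0.15]`, `0 < U ≤ 1/10`. -/
theorem sub_half_mem_klWindowC {μ U : ℝ} (hμ : μ ∈ Set.Icc (-1 : ℝ) (-0.15)) (hU : 0 < U) (hU' : U ≤ 1 / 10) :
    μ - U / 2 ∈ klWindowC := by
  obtain ⟨h₁, h₂⟩ := hμ
  constructor <;> linarith

/-! ## §2 The window-parametrised children (covariance potentials `μ ∈ W`) -/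

/-- **Child 3, `EngineOn W` (route name `KLRegimeEngine` at `W = klWindowC`; rank 2; DECOMP C5b + C4a's two-leg output in the CT
scheme).**  There are absolute constants `G` such that for every choice `P` of the flow's induction constants there are engine
constants `Q` such that for every renormalisation package `R` and every regime constant `c > 0` there are `U₀ > 0` and thresholds
`L₃ β U`, `M₃ β U L` with: for every covariance potential `μ ∈ W`, `0 < U ≤ U₀`, `klBetaMin ≤ β ≤ e^{c/U²}`, every ADMISSIBLE frame
`K` (`FrameOK`), every `L ≥ L₃ β U`, `M ≥ M₃ β U L` and every scale `n ≤ n_β` in the KL regime: IF the history `Child.Hist n` holds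
(split, renormalisation, engine bounds, two-leg step at all `j < n`), THEN `EngineBoundsAt n` and `TwoLegStep n` hold — the
`n!`-free fermionic tree expansion with anisotropic sectors for OUR action, one scale at a time. -/
def EngineOn (W : Set ℝ) : Prop :=
  ∃ G : GeoConsts, G.WF ∧ ∀ P : SplitConsts, P.WF → ∃ Q : EngConsts, Q.WF ∧ ∀ R : RenConsts, R.WF → ∀ c : ℝ, 0 < c →
    ∃ U₀ : ℝ, 0 < U₀ ∧ ∃ L₃ : ℝ → ℝ → ℕ, ∃ M₃ : ℝ → ℝ → ℕ → ℕ,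
      ∀ μ ∈ W, ∀ U : ℝ, 0 < U → U ≤ U₀ → ∀ β : ℝ, klBetaMin ≤ β → β ≤ Real.exp (c / U ^ 2) →
        ∀ K : TrigPolyC4v, FrameOK R U (nScales β) μ K →
          ∀ (L M : ℕ) [NeZero L] [NeZero M], L₃ β U ≤ L → M₃ β U L ≤ M →
            ∀ n : ℕ, n ≤ nScales β → IsKLRegime U c (-(n : ℤ)) → Child.Hist L M G P Q R β U μ K n →
              EngineBoundsAt L M G P Q β U μ K n ∧ TwoLegStep L M G P Q R β U μ K n

/-- **Child 1, `BetaSplitOn W` (route name `KLRegimeBetaSplit` at `W = klWindowC`; rank 3; DECOMP C1 = Lemma E.4 as ONE cascade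
step).**  For all absolute constants `G` there are induction constants `P` such that for all engine constants `Q` there is
`c₀ > 0` (no onset: where `β ≤ e^{c/U²}` is spent) such that for every `0 < c ≤ c₀` and every `R` there are `U₀ > 0` and
thresholds `L₁ β U`, `M₁ β U L` with: for every covariance potential `μ ∈ W`, in the regime, for every admissible frame, every
large volume and every scale `n ≤ n_β`: the history below `n` with the engine's scale-`n` output (`EngineBoundsAt n`,
`TwoLegStep n`) gives the split AT scale `n` (C2's envelopes on (E2); (E2′) + Lemma E.1/E.3's freezing). -/
def BetaSplitOn (W : Set ℝ) : Prop :=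
  ∀ G : GeoConsts, G.WF → ∃ P : SplitConsts, P.WF ∧ ∀ Q : EngConsts, Q.WF → ∃ c₀ : ℝ, 0 < c₀ ∧
    ∀ c : ℝ, 0 < c → c ≤ c₀ → ∀ R : RenConsts, R.WF →
      ∃ U₀ : ℝ, 0 < U₀ ∧ ∃ L₁ : ℝ → ℝ → ℕ, ∃ M₁ : ℝ → ℝ → ℕ → ℕ,
        ∀ μ ∈ W, ∀ U : ℝ, 0 < U → U ≤ U₀ → ∀ β : ℝ, klBetaMin ≤ β → β ≤ Real.exp (c / U ^ 2) →
          ∀ K : TrigPolyC4v, FrameOK R U (nScales β) μ K →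
            ∀ (L M : ℕ) [NeZero L] [NeZero M], L₁ β U ≤ L → M₁ β U L ≤ M →
              ∀ n : ℕ, n ≤ nScales β → IsKLRegime U c (-(n : ℤ)) → Child.Hist L M G P Q R β U μ K n →
                EngineBoundsAt L M G P Q β U μ K n → TwoLegStep L M G P Q R β U μ K n →
                  BetaSplitAt L M G P Q β U μ K n

/-- **Child 2, `CountertermOn W` (route name `KLRegimeCounterterm` at `W = klWindowC`; rank 4; DECOMP C4 in the counterterm scheme
= FST's inversion by successive approximation), VOLUME-UNIFORM.**  For all `G, P, Q` there are a renormalisation package `R` and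
`c₁ > 0` such that for every `0 < c ≤ c₁` there is `U₀ > 0` with: at every covariance potential `μ ∈ W` and regime point `(U, β)`
and for ANY thresholds `(Lh, Mh)`: IF for every admissible frame `K` and every `L ≥ Lh`, `M ≥ Mh L` the frame's renormalisation
below `n` yields the engine's output, the two-leg step and the split at `n` (all `n ≤ n_β`), THEN there is ONE admissible frame `K`
(chosen BEFORE the volume) with thresholds `(Lc, Mc)` such that `K` is renormalised down to every scale `n ≤ n_β` at every
`L ≥ Lc`, `M ≥ Mc L` (self-map of the frame ball from the sizes + tangential floor of (E3); contraction from `FrameLipschitz`;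
finite-volume / Matsubara corrections inside the tolerances). -/
def CountertermOn (W : Set ℝ) : Prop :=
  ∀ G : GeoConsts, ∀ P : SplitConsts, ∀ Q : EngConsts, G.WF → P.WF → Q.WF →
    ∃ R : RenConsts, R.WF ∧ ∃ c₁ : ℝ, 0 < c₁ ∧ ∀ c : ℝ, 0 < c → c ≤ c₁ → ∃ U₀ : ℝ, 0 < U₀ ∧
      ∀ μ ∈ W, ∀ U : ℝ, 0 < U → U ≤ U₀ → ∀ β : ℝ, klBetaMin ≤ β → β ≤ Real.exp (c / U ^ 2) →
        ∀ (Lh : ℕ) (Mh : ℕ → ℕ),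
          (∀ K : TrigPolyC4v, FrameOK R U (nScales β) μ K →
            ∀ (L M : ℕ) [NeZero L] [NeZero M], Lh ≤ L → Mh L ≤ M →
              ∀ n : ℕ, n ≤ nScales β → (∀ j < n, RenormalisedAt L M β U μ K R j) →
                EngineBoundsAt L M G P Q β U μ K n ∧ TwoLegStep L M G P Q R β U μ K n ∧
                  BetaSplitAt L M G P Q β U μ K n) →
          ∃ K : TrigPolyC4v, FrameOK R U (nScales β) μ K ∧ ∃ (Lc : ℕ) (Mc : ℕ → ℕ),
            ∀ (L M : ℕ) [NeZero L] [NeZero M], Lc ≤ L → Mc L ≤ M →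
              ∀ n : ℕ, n ≤ nScales β → RenormalisedAt L M β U μ K R n

/-- **Child 4, `TwoPointAssemblyOn W` (route name `KLRegimeTwoPointAssembly` at `W = klWindowC`; rank 5; BGM 2006 §2.4 /
Lemmas 2.4–2.5 role), HARTREE-CORRECT.**  For all constants and every `c > 0` there is `U₀ > 0` with: at every covariance potential
`μ ∈ W` and regime point `(U, β)`, IF there is ONE admissible frame `K` renormalised, split, engine-bounded and two-leg-controlled at
every scale `n ≤ n_β` for all `L ≥ L⋆`, `M ≥ M⋆ L` (all at the COVARIANCE potential `μ` of the Grassmann carrier), THEN the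
finite-volume equal-time thermal two-point functions of the Hubbard torus at the PHYSICAL potential `μ + U/2` converge as `L → ∞`
(one scale decomposition in a fixed frame: termwise volume limits + uniform tails; `M → ∞` first —
`tendsto_grassmannTwoPoint_eq_hubbardThermalTwoPoint_sub` carries the shift `μ ↦ μ + U/2`). -/
def TwoPointAssemblyOn (W : Set ℝ) : Prop :=
  ∀ G : GeoConsts, ∀ P : SplitConsts, ∀ Q : EngConsts, ∀ R : RenConsts, G.WF → P.WF → Q.WF → R.WF →
    ∀ c : ℝ, 0 < c → ∃ U₀ : ℝ, 0 < U₀ ∧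
      ∀ μ ∈ W, ∀ U : ℝ, 0 < U → U ≤ U₀ → ∀ β : ℝ, klBetaMin ≤ β → β ≤ Real.exp (c / U ^ 2) →
        ∀ (Lstar : ℕ) (Mstar : ℕ → ℕ),
          (∃ K : TrigPolyC4v, FrameOK R U (nScales β) μ K ∧
            ∀ (L M : ℕ) [NeZero L] [NeZero M], Lstar ≤ L → Mstar L ≤ M → ∀ n : ℕ, n ≤ nScales β →
              RenormalisedAt L M β U μ K R n ∧ BetaSplitAt L M G P Q β U μ K n ∧
                EngineBoundsAt L M G P Q β U μ K n ∧ TwoLegStep L M G P Q R β U μ K n) →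
          ∀ (x y : Site 2) (σ σ' : Fin 2), ∃ S : ℂ,
            Tendsto (fun L : ℕ => hubbardThermalTwoPoint β U (μ + U / 2) L x y σ σ') atTop (nhds S)

/-! ## §3 The glue -/

/-- **GLUE for a covariance window `W` receiving `μ - U/2`**: if every physical `μ ∈ [-1, -0.15]` and `0 < U ≤ 1/10` has
`μ - U/2 ∈ W`, the four children on `W` give K3 on the analysis window `KLRegimeTwoPointLimitMu (-1) (-0.15)` (= the registered
stub `KLRegimeAnalysisWindow`).  Order of choices: `G` (child 3) → `P` (child 1) → `Q` (child 3) → `c₀` (child 1), `(R, c₁)`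
(child 2) → `c = min c₀ c₁` → the four `U₀`'s, `a / log 128` and `1/10` → per `(μ, U, β)` at the covariance potential
`μ - U/2`: the hypothesis thresholds of children 3 + 1 maxed, the strong induction `Child.allScales` for every admissible frame,
child 2's volume-uniform frame with its thresholds, child 4 beyond the max of all thresholds — whose conclusion at
`(μ - U/2) + U/2 = μ` is K3's. -/
theorem inductionOn {W : Set ℝ}
    (hW : ∀ μ ∈ Set.Icc (-1 : ℝ) (-0.15), ∀ U : ℝ, 0 < U → U ≤ 1 / 10 → μ - U / 2 ∈ W)
    (h₃ : EngineOn W) (h₁ : BetaSplitOn W) (h₂ : CountertermOn W) (h₄ : TwoPointAssemblyOn W) :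
    KLRegimeTwoPointLimitMu (-1) (-0.15) := by
  intro a ha
  obtain ⟨G, hG, h₃P⟩ := h₃
  obtain ⟨P, hP, h₁Q⟩ := h₁ G hG
  obtain ⟨Q, hQ, h₃R⟩ := h₃P P hP
  obtain ⟨c₀, hc₀, h₁c⟩ := h₁Q Q hQ
  obtain ⟨R, hR, c₁, hc₁, h₂c⟩ := h₂ G P Q hG hP hQ
  set c : ℝ := min c₀ c₁ with hc_def
  have hc : 0 < c := lt_min hc₀ hc₁
  obtain ⟨U₃, hU₃, L₃, M₃, h₃main⟩ := h₃R R hR c hc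
  obtain ⟨U₁, hU₁, L₁, M₁, h₁main⟩ := h₁c c hc (min_le_left _ _) R hR
  obtain ⟨U₂, hU₂, h₂main⟩ := h₂c c hc (min_le_right _ _)
  obtain ⟨U₄, hU₄, h₄main⟩ := h₄ G P Q R hG hP hQ hR c hc
  have hlog : 0 < Real.log klBetaMin := Real.log_pos (by norm_num [klBetaMin])
  set U₀ : ℝ := min (min (min (min U₁ U₂) (min U₃ U₄)) (a / Real.log klBetaMin)) (1 / 10) with hU₀_def
  have hU₀ : 0 < U₀ :=
    lt_min (lt_min (lt_min (lt_min hU₁ hU₂) (lt_min hU₃ hU₄)) (div_pos ha hlog)) (by norm_num)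
  refine ⟨U₀, c, hU₀, hc, ?_⟩
  intro μ hμ U β hU hUle hβa hβc x y σ σ'
  have hU5 : U ≤ min (min (min U₁ U₂) (min U₃ U₄)) (a / Real.log klBetaMin) := hUle.trans (min_le_left _ _)
  have hU10 : U ≤ 1 / 10 := hUle.trans (min_le_right _ _)
  have hU1 : U ≤ U₁ := hU5.trans ((min_le_left _ _).trans ((min_le_left _ _).trans (min_le_left _ _)))
  have hU2 : U ≤ U₂ := hU5.trans ((min_le_left _ _).trans ((min_le_left _ _).trans (min_le_right _ _)))
  have hU3 : U ≤ U₃ := hU5.trans ((min_le_left _ _).trans ((min_le_right _ _).trans (min_le_left _ _)))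
  have hU4 : U ≤ U₄ := hU5.trans ((min_le_left _ _).trans ((min_le_right _ _).trans (min_le_right _ _)))
  have hβmin : klBetaMin ≤ β := klBetaMin_le_of_exp_le hU hU5 (min_le_right _ _) hβa
  have hβpos : 0 < β := pos_of_klBetaMin_le hβmin
  have hKL : ∀ n ≤ nScales β, IsKLRegime U c (-(n : ℤ)) := fun n hn =>
    isKLRegime_of_le_tempScaleIdx hc.le hβpos hβc hn
  -- the covariance potential
  set ν : ℝ := μ - U / 2 with hν_def
  have hν : ν ∈ W := hW μ hμ U hU hU10
  -- the glued induction (children 3 + 1) for EVERY admissible frame, beyond the maxed hypothesis thresholds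
  have hall : ∀ K : TrigPolyC4v, FrameOK R U (nScales β) ν K →
      ∀ (L M : ℕ) [NeZero L] [NeZero M], max (L₃ β U) (L₁ β U) ≤ L → max (M₃ β U L) (M₁ β U L) ≤ M →
        ∀ n : ℕ, n ≤ nScales β → (∀ j < n, RenormalisedAt L M β U ν K R j) →
          EngineBoundsAt L M G P Q β U ν K n ∧ TwoLegStep L M G P Q R β U ν K n ∧
            BetaSplitAt L M G P Q β U ν K n := by
    intro K hK L M _ _ hL hM n hn hRn
    have hL3 : L₃ β U ≤ L := (le_max_left _ _).trans hL
    have hL1 : L₁ β U ≤ L := (le_max_right _ _).trans hL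
    have hM3 : M₃ β U L ≤ M := (le_max_left _ _).trans hM
    have hM1 : M₁ β U L ≤ M := (le_max_right _ _).trans hM
    exact Child.allScales (N := nScales β) (KL := fun n => IsKLRegime U c (-(n : ℤ)))
      (B := fun n => BetaSplitAt L M G P Q β U ν K n) (Rn := fun n => RenormalisedAt L M β U ν K R n)
      (E := fun n => EngineBoundsAt L M G P Q β U ν K n) (T := fun n => TwoLegStep L M G P Q R β U ν K n)
      (fun n hn hkl hyp => h₃main ν hν U hU hU3 β hβmin hβc K hK L M hL3 hM3 n hn hkl hyp)
      (fun n hn hkl hyp hEn hTn => h₁main ν hν U hU hU1 β hβmin hβc K hK L M hL1 hM1 n hn hkl hyp hEn hTn)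
      hKL n hn hRn
  -- child 2: the volume-uniform renormalised admissible frame and its thresholds
  obtain ⟨K, hK, Lc, Mc, hKR⟩ :=
    h₂main ν hν U hU hU2 β hβmin hβc (max (L₃ β U) (L₁ β U)) (fun L => max (M₃ β U L) (M₁ β U L)) hall
  -- child 4 at the covariance potential, beyond every threshold; its conclusion is at ν + U/2 = μ
  have hphys : ν + U / 2 = μ := by rw [hν_def]; ring
  have h4 := h₄main ν hν U hU hU4 β hβmin hβc (max Lc (max (L₃ β U) (L₁ β U)))
    (fun L => max (Mc L) (max (M₃ β U L) (M₁ β U L))) ⟨K, hK, ?_⟩ x y σ σ'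
  · rwa [hphys] at h4
  intro L M _ _ hL hM n hn
  have hLc : Lc ≤ L := (le_max_left _ _).trans hL
  have hLh : max (L₃ β U) (L₁ β U) ≤ L := (le_max_right _ _).trans hL
  have hMc : Mc L ≤ M := (le_max_left _ _).trans hM
  have hMh : max (M₃ β U L) (M₁ β U L) ≤ M := (le_max_right _ _).trans hM
  have h := hall K hK L M hLh hMh n hn fun j hj => hKR L M hLc hMc j (le_of_lt (lt_of_lt_of_le hj hn))
  exact ⟨hKR L M hLc hMc n hn, h.2.2, h.1, h.2.1⟩

/-- **GLUE for the filed children**: the four children on the covariance window `klWindowC` give K3 on the analysis window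
(`KLRegimeAnalysisWindow`; K3 itself follows with S0 — `k3_twoPointLimit_of_children`, and BY NAME downstream in
`KLProgrammeKLRegimeSplitGlue.lean`). -/
theorem k3_induction (h₃ : EngineOn klWindowC) (h₁ : BetaSplitOn klWindowC) (h₂ : CountertermOn klWindowC)
    (h₄ : TwoPointAssemblyOn klWindowC) : KLRegimeTwoPointLimitMu (-1) (-0.15) :=
  inductionOn (fun _ hμ _ hU hU' => sub_half_mem_klWindowC hμ hU hU') h₃ h₁ h₂ h₄

/-- **The crux modulo S0, from the filed children**: with `μ(δ) ∈ [-1, -0.15]` for `δ ∈ [0.10, 0.35]` (S0 `MuOfDopingWindow`,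
stated structurally to keep this module free of the route file) the four children give `KLRegimeTwoPointLimit`'s body. -/
theorem k3_twoPointLimit_of_children (h₃ : EngineOn klWindowC) (h₁ : BetaSplitOn klWindowC)
    (h₂ : CountertermOn klWindowC) (h₄ : TwoPointAssemblyOn klWindowC)
    (hS0 : ∀ δ ∈ Set.Icc (0.10 : ℝ) 0.35,
      chemicalPotentialOfDensity (squareDispersion 1 0) (1 - δ) ∈ Set.Icc (-1 : ℝ) (-0.15)) :
    ∀ a : ℝ, 0 < a → ∃ U₀ c : ℝ, 0 < U₀ ∧ 0 < c ∧ ∀ δ ∈ Set.Icc (0.10 : ℝ) 0.35, ∀ U β : ℝ, 0 < U → U ≤ U₀ →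
      Real.exp (a / U) ≤ β → β ≤ Real.exp (c / U ^ 2) → ∀ (x y : Site 2) (σ σ' : Fin 2), ∃ S : ℂ,
        Tendsto (fun L : ℕ => hubbardThermalTwoPoint β U
          (chemicalPotentialOfDensity (squareDispersion 1 0) (1 - δ)) L x y σ σ') atTop (nhds S) := by
  intro a ha
  obtain ⟨U₀, c, hU₀, hc, H⟩ := k3_induction h₃ h₁ h₂ h₄ a ha
  exact ⟨U₀, c, hU₀, hc, fun δ hδ U β hU hUle hβ hβ' x y σ σ' => H _ (hS0 δ hδ) U β hU hUle hβ hβ' x y σ σ'⟩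

end Summit.HubbardSuperconductivity.HubbardSuperconductivity.Theorems.KLRegimeSplit

end
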